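import Mathlib
import HarnessLib

/-!
# Venture HSemireg — the g = 8 family-A flat-menu census (rows A17-J9 ∕ J10 ∕ J11), SUPPORT COUNTS: the non-zero `{0,±1}`-vectors on
# the Klein quadric in `ℤ⁶` number `2·122` — by support size `2·(6, 24, 32, 12, 48, 0)` — and those of support `≤ 4` number `2·74`

HONEST FRAMING. Part of the Lean index of the computation cell `pub-hsemireg` (Sunday typer seat p9, § g = 8; companion of
`FlatMenuFrameLemma.lean` ∕ `FlatMenuFrameInstances.lean`, census rows **A17-J9, A17-J10, A17-J11** of `target-g8/CENSUS.md` v1.274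
`7744dc4867915f69`, family A, n = 4, door (4) «hunt representatives»). FINITE COUNTING ONLY: an explicit list of the 3⁶ = 729 vectors
`{−1,0,1}⁶`, one quadratic form, and `decide`. No abelian variety, plane, lattice or class is constructed; the DICTIONARY («an integral
plane W ⊂ ℤ⁴ ↦ its primitive Plücker vector ±P(W) ∈ ℤ⁶ on the Klein quadric, injectively, so counting P's counts planes»; «δ_W =
2·#supp P») is TEXT OF RECORD, not a binder; the numbers 122 and 74 are the HAND counts of record (th-1 g39, t-17 g7), here re-counted by
the kernel as 244 = 2·122 and 148 = 2·74 (P and −P both listed); the machine censuses over these planes (4475 class solutions, Stage B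
4384 ∕ 90 ∕ 1) stay machine and are NOT reproduced; nothing here says that HC ∕ HC_CM ∕ HC_AV holds; no object is certified; no
Literature fact is declared.

TEXTS OF RECORD (quoted, not interpreted). t-17 g7 `target-g8/FAMILY-A-G8-t17-g7.md` v1.7 `30f228fa15a40313` §4.7.5: «Write P(W) ∈ ℤ⁶
for the Plücker vector (P_ab)_{a<b} of the annihilator W^⊥ … it is PRIMITIVE (W^⊥ is saturated), lies on the Klein quadric P₁₂P₃₄ −
P₁₃P₂₄ + P₁₄P₂₃ = 0, and W ↦ ±P(W) is injective»; «LEMMA (hand ×2). In every class solution every member has all P_ab(W_j) ∈ {0, ±1};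
hence δ_{W_j} = 2·#supp P(W_j) ∈ {2, 4, 6, 8, 10} and W_j is one of 6 + 24 + 32 + 12 + 48 = 122 planes. … Support 6 is impossible
(the Klein relation would be a sum of three odd numbers); a support containing exactly one complementary pair {ab, cd} ({a,b,c,d} =
{1,2,3,4}) violates the relation; the admissible supports of sizes 1, …, 5 with signs modulo ±1 number 6, 12·2 = 24, 8·4 = 32, 3·4 =
12, 6·8 = 48 — the coordinate, semi-diagonal, degree-6, pairing planes of §4.7 and 48 planes of degree 10». th-1 g39 INBOX l.7245
(hand ×2 read): «SUPPORT COUNT for P ∈ {0,±1}⁶ mod ± on P₁₂P₃₄ − P₁₃P₂₄ + P₁₄P₂₃ = 0 (three complementary slot-pairs): … size 1: 6 ×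
1 sign class = 6; size 2: C(6,2) − 3 = 12 non-complementary pairs × 2 = 24; size 3: one slot from each pair, 2³ = 8 supports … × 4 =
32; size 4: exactly two complete pairs, 3 supports, 2⁴ signs halved by the relation = 8, mod ± = 4 ⇒ 12; size 5: 6 supports … ⇒ 48;
total 6 + 24 + 32 + 12 + 48 = 122 ✓, δ = 2·#supp ∈ {2,4,6,8,10} ✓». §4.7.6 CONSEQUENCE (a) ∕ th-1 l.7642 (i): «over ℤ this is
«support ≤ 4», so of my 122 admissible {0,±1}-planes exactly the 6 + 24 + 32 + 12 = 74 of degree ≤ 8 can ever occur (the 48 support-5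
planes never do)».

WHAT THIS FILE PROVES (kernel, `decide`). `klein P = P 0 * P 5 − P 1 * P 4 + P 2 * P 3` in the slot order (12,13,14,23,24,34);
`smallVecs` = the 729 vectors `{−1,0,1}⁶` as a list, `mem_smallVecs` (every vector with `|P a| ≤ 1` is listed — so the counts apply
to every member of an integral tight frame with primitive members, `FlatFrame.int_natAbs_le_one` of the companion file);
`smallKlein` = its non-zero members on the quadric; **`length_smallKlein` = 244 = 2·122**; **`length_smallKlein_by_support` =
(12, 48, 64, 24, 96, 0) = 2·(6, 24, 32, 12, 48, 0)**; **`length_smallKlein_supp_le_four` = 148 = 2·74**; and, for every small vector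
(not only as a count), `klein_ne_zero_of_full_support` («a sum of three odd numbers») and `klein_ne_zero_of_one_pair` («a support
containing exactly one complementary pair violates the relation»).

WHAT IS NOT HERE. Which planes these vectors are (coordinate ∕ semi-diagonal ∕ A₂ ∕ pairing — dictionary), the «other 48» vectors
of the degree ≤ 10 universe with an entry ±2 (170 = 122 + 48; they are not primitive members by the FRAME LEMMA), the O_K universes
(8006 ∕ 28698 ∕ 710 ∕ 618 — machine), and every class-solution census.
-/

namespace Summit.Ventures.HSemireg.FlatFrame

open Finset

/-- The KLEIN FORM in the slot order `(12, 13, 14, 23, 24, 34) = (0, 1, 2, 3, 4, 5)`: `P₁₂P₃₄ − P₁₃P₂₄ + P₁₄P₂₃`; its zero set is the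
Klein quadric (decomposable Plücker vectors); the three complementary slot pairs are `(0,5), (1,4), (2,3)`. [definition of this file] -/
def klein (P : Fin 6 → ℤ) : ℤ := P 0 * P 5 - P 1 * P 4 + P 2 * P 3

/-- Support size `#supp P = #{a : P(a) ≠ 0}` («δ_W = 2·#supp P(W)» for `{0,±1}`-vectors). [definition of this file] -/
def suppCard (P : Fin 6 → ℤ) : ℕ := (Finset.univ.filter (fun a => P a ≠ 0)).card

/-- Number of COMPLETE complementary slot pairs `{ab, cd}` (`{a,b,c,d} = {1,2,3,4}`) inside the support: pairs `(0,5), (1,4), (2,3)`.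
[definition of this file] -/
def pairCount (P : Fin 6 → ℤ) : ℕ :=
  (if P 0 ≠ 0 ∧ P 5 ≠ 0 then 1 else 0) + (if P 1 ≠ 0 ∧ P 4 ≠ 0 then 1 else 0) + (if P 2 ≠ 0 ∧ P 3 ≠ 0 then 1 else 0)

/-- The 3⁶ = 729 SMALL VECTORS `{−1,0,1}⁶`, as an explicit list. [definition of this file] -/
def smallVecs : List (Fin 6 → ℤ) :=
  [-1, 0, 1].flatMap fun a => [-1, 0, 1].flatMap fun b => [-1, 0, 1].flatMap fun c =>
    [-1, 0, 1].flatMap fun d => [-1, 0, 1].flatMap fun e => [-1, 0, 1].map fun f => ![a, b, c, d, e, f]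

/-- `smallVecs` has 729 entries. -/
theorem length_smallVecs : smallVecs.length = 729 := by decide +kernel

/-- A vector with all entries in `{0, ±1}` is in the list `smallVecs`. -/
theorem mem_smallVecs {P : Fin 6 → ℤ} (hP : ∀ a, (P a).natAbs ≤ 1) : P ∈ smallVecs := by
  have h : ∀ a, P a ∈ ([-1, 0, 1] : List ℤ) := fun a => by
    have := hP a; simp only [List.mem_cons, List.not_mem_nil, or_false]; omega
  have hPe : P = ![P 0, P 1, P 2, P 3, P 4, P 5] := by ext i; fin_cases i <;> rfl
  simp only [smallVecs, List.mem_flatMap, List.mem_map]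
  exact ⟨P 0, h 0, P 1, h 1, P 2, h 2, P 3, h 3, P 4, h 4, P 5, h 5, hPe.symm⟩

/-- Conversely every listed vector has all entries in `{0, ±1}`. -/
theorem natAbs_le_one_of_mem_smallVecs : ∀ P ∈ smallVecs, ∀ a, (P a).natAbs ≤ 1 := by decide +kernel

/-- The non-zero small vectors ON THE KLEIN QUADRIC («counting P's counts planes», th-1 l.7245), `P` and `−P` both listed.
[definition of this file] -/
def smallKlein : List (Fin 6 → ℤ) := smallVecs.filter fun P => decide (P ≠ 0 ∧ klein P = 0)

/-- Membership in `smallKlein`, unfolded. -/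
theorem mem_smallKlein {P : Fin 6 → ℤ} : P ∈ smallKlein ↔ P ∈ smallVecs ∧ P ≠ 0 ∧ klein P = 0 := by
  simp only [smallKlein, List.mem_filter, decide_eq_true_eq]

/-- **THE 122 ADMISSIBLE PLANES (×2 for ±P):** exactly `244 = 2·122` non-zero `{0,±1}`-vectors lie on the Klein quadric («total
6 + 24 + 32 + 12 + 48 = 122 ✓», th-1 l.7245; §4.7.5). Kernel `decide` over the 729-entry list. -/
theorem length_smallKlein : smallKlein.length = 244 := by decide +kernel

/-- **… BY SUPPORT SIZE:** `(12, 48, 64, 24, 96, 0) = 2·(6, 24, 32, 12, 48, 0)` vectors of support sizes `1, …, 6` («size 1: 6; size 2: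
… 24; size 3: … 32; size 4: … 12; size 5: … 48» and «Support 6 is impossible», §4.7.5 ∕ th-1 l.7245); with «δ = 2·#supp»: θ-degrees
2, 4, 6, 8, 10 occur `2·(6, 24, 32, 12, 48)` times. -/
theorem length_smallKlein_by_support :
    ((smallKlein.filter fun P => decide (suppCard P = 1)).length,
     (smallKlein.filter fun P => decide (suppCard P = 2)).length,
     (smallKlein.filter fun P => decide (suppCard P = 3)).length,
     (smallKlein.filter fun P => decide (suppCard P = 4)).length,
     (smallKlein.filter fun P => decide (suppCard P = 5)).length,
     (smallKlein.filter fun P => decide (suppCard P = 6)).length) = (12, 48, 64, 24, 96, 0) := by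
  decide +kernel

/-- **THE 74 PLANES OF DEGREE ≤ 8 (×2 for ±P):** exactly `148 = 2·74 = 2·(6 + 24 + 32 + 12)` non-zero `{0,±1}`-vectors on the Klein
quadric have support of size ≤ 4 — by `FlatFrame.int_card_support_le_four` (LEMMA (M)) the only ones that can be members of an integral
tight frame («exactly the 6 + 24 + 32 + 12 = 74 of degree ≤ 8 can ever occur (the 48 support-5 planes never do)», th-1 l.7642 (i)). -/
theorem length_smallKlein_supp_le_four : (smallKlein.filter fun P => decide (suppCard P ≤ 4)).length = 148 := by
  decide +kernel

/-- **… BY COMPLETE COMPLEMENTARY PAIRS:** the admissible supports «carry 0 or 2 complete pairs» (th-1 l.7245): of the 244 vectors,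
`12 + 48 + 64 = 124` contain no complete pair and `24 + 96 = 120` contain exactly two; none contains exactly one or three. -/
theorem length_smallKlein_by_pairCount :
    ((smallKlein.filter fun P => decide (pairCount P = 0)).length,
     (smallKlein.filter fun P => decide (pairCount P = 1)).length,
     (smallKlein.filter fun P => decide (pairCount P = 2)).length,
     (smallKlein.filter fun P => decide (pairCount P = 3)).length) = (124, 0, 120, 0) := by
  decide +kernel

/-- For EVERY `{0,±1}`-vector (a statement, not a count): FULL support is impossible on the Klein quadric («the Klein relation would
be a sum of three odd numbers», §4.7.5). -/
theorem klein_ne_zero_of_full_support {P : Fin 6 → ℤ} (hP : ∀ a, (P a).natAbs ≤ 1) (hfull : ∀ a, P a ≠ 0) :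
    klein P ≠ 0 := by
  have key : ∀ Q ∈ smallVecs, (∀ a, Q a ≠ 0) → klein Q ≠ 0 := by decide +kernel
  exact key P (mem_smallVecs hP) hfull

/-- For EVERY `{0,±1}`-vector: a support containing EXACTLY ONE complete complementary pair is impossible on the Klein quadric («a
support containing exactly one complementary pair {ab, cd} violates the relation», §4.7.5; «±1 + 0 + 0 ≠ 0», th-1 l.7245). -/
theorem klein_ne_zero_of_one_pair {P : Fin 6 → ℤ} (hP : ∀ a, (P a).natAbs ≤ 1) (hone : pairCount P = 1) :
    klein P ≠ 0 := by
  have key : ∀ Q ∈ smallVecs, pairCount Q = 1 → klein Q ≠ 0 := by decide +kernel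
  exact key P (mem_smallVecs hP) hone

/-- The count statements as a MEMBERSHIP statement for an arbitrary vector: a non-zero `{0,±1}`-vector on the Klein quadric with
support of size ≤ 4 has support of size 1, 2, 3 or 4 and is one of the 148 listed vectors of `length_smallKlein_supp_le_four`. -/
theorem mem_filter_of_small_klein {P : Fin 6 → ℤ} (hP : ∀ a, (P a).natAbs ≤ 1) (h0 : P ≠ 0) (hk : klein P = 0)
    (h4 : suppCard P ≤ 4) : P ∈ smallKlein.filter fun Q => decide (suppCard Q ≤ 4) := by
  rw [List.mem_filter, decide_eq_true_eq]
  exact ⟨mem_smallKlein.mpr ⟨mem_smallVecs hP, h0, hk⟩, h4⟩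

end Summit.Ventures.HSemireg.FlatFrame
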